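import Literature.Probability.RandomPlanarGeometry.HexSAWBrickWallStripFugacityWidthOneContactVariance
import HarnessLib

/-!
# The mean contact number to second order: `⟨bc⟩_{N,y,z} − N·b(y,z) → γ_{N mod 2}(y,z) = d/dA log A_{N mod 2}(e^A, z)|_{A = log y}`

Topic `Literature/Probability/RandomPlanarGeometry` (continues `HexSAWBrickWallStripFugacityWidthOneContactVariance.lean`: the contact free energy
`F_N(t) = log C_{1,N}(ye^t,z)` of the width-one two-wall strip is convex with `F_N'(0) = ⟨bc⟩_{N,y,z}`, the parity amplitudes `A_c` are positive
and `log A_c(e^A,z)` is `C²` in `A`; and `…UniformAmplitude.lean`: `|F_N(t) − Nφ(t) − G_c(t)| ≤ ε_N` uniformly near `t = 0` with `Nε_N → 0`).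
The tree has the law of large numbers `⟨bc⟩/N → b(y,z)` (`tendsto_meanContacts_div`) and the variance theorem; THIS FILE gives the
`O(1)` term of the mean:

  ★★★ `tendsto_meanContacts_sub_linear`: for `y, z > 0` and `c ∈ {0,1}`,
      `⟨bc⟩_{2M+c,y,z} − (2M+c)·b(y,z) → γ_c(y,z) := deriv (A ↦ log A_c(e^A, z)) (log y)`.

Because `A₀ ≠ A₁` for unequal walls (tree: `not_tendsto_stripZ₂_one_two_one`), the correction is in general PARITY-DEPENDENT:
`⟨bc⟩_N − N·b` oscillates with period two (numerics below: `(y,z) = (2,1)`: `γ₀ = +0.0172`, `γ₁ = −0.0859`).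

* §1 (private) `derivData_of_contDiff_two'` (copy of the parent's private plumbing), `abs_deriv_sub_le_of_convex_squeeze`: if `f` has a monotone derivative `f₁` on `(−τ,τ)`, `g` is `C²` there with `|g''| ≤ L`, and
  `|f − g| ≤ ε`, then `|f₁(0) − g'(0)| ≤ L·h + 2ε/h` for every `0 < h < τ` (two mean-value steps); (private) `squeeze_scale_tendsto`
  (the scale `h_M = √((ε_M + (M+1)⁻³)/(M+1))` makes `(a(M+1) + b)h_M + 2ε_M/h_M → 0` whenever `Mε_M → 0`).
* §2 ★★★ `tendsto_meanContacts_sub_linear` (the squeeze with `f = F_{2M+c}`, `g = M·2Λ(A₀+·) + G_c`, `L = O(M)`, `ε = ε_M` of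
  `exists_uniform_log_two_term`; `g'(0) = (2M+c)·b + γ_c`).

Numerics (`mean_check.py`, exact enumeration from the rational series vs the closed-form amplitudes): `(1,1)`: `⟨bc⟩_N − N b = 0.241811 (N=40),
0.241871 (N = 120, 240, 241) = γ₀ = γ₁ = 0.241871`; `(2,1)`: even `N`: `+0.017168 = γ₀`, odd `N`: `−0.085934 = γ₁` (6 digits from `N = 120`);
`(½,3)`: `γ₀ = 0.202618`, `γ₁ = 0.311188`, matched to 6 digits.

## Sources
A. Dembo, O. Zeitouni, *Large Deviations Techniques and Applications* (2010) §2.3 (the quasi-linear free energy; lane statement of the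
first-order consequence); N. Madras, G. Slade, *The Self-Avoiding Walk* (1993) §1.1 eq. (1.1.4) p. 5 (amplitudes); N. R. Beaton,
M. Bousquet-Mélou, J. de Gier, H. Duminil-Copin, A. J. Guttmann, CMP 326 (2014), arXiv:1109.0358v5 §3.2 Proposition 6 (p. 10).  Nothing is quoted
AS PRINTED; the statement and its constants are this lineage's.
-/

noncomputable section

open Filter Topology Finset Set Literature.Analysis Literature.Probability.Moments
open Literature.Probability.LatticeModels Literature.Probability.Percolation

namespace Literature.Probability.RandomPlanarGeometry.SAW.HexBW

namespace WidthOneYZ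

variable {y z : ℝ}

/-! ## §1 A convex squeeze: the derivative of a convex function close to a `C²` one -/

/-- (plumbing; private copy of the parent's private lemma) Derivative data from `C²`: `g' = deriv g`, `g'' = deriv (deriv g)` as
`HasDerivAt`, `deriv (deriv g)` continuous and bounded on every compact interval. [cite: DemboZeitouni2010, §2.3 (lane plumbing)] -/
private theorem derivData_of_contDiff_two' {g : ℝ → ℝ} (hg : ContDiff ℝ 2 g) (τ : ℝ) :
    (∀ t, HasDerivAt g (deriv g t) t) ∧ (∀ t, HasDerivAt (deriv g) (deriv (deriv g) t) t) ∧
      Continuous (deriv (deriv g)) ∧ ∃ B, ∀ t ∈ Icc (-τ) τ, |deriv (deriv g) t| ≤ B := by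
  have h1 : Differentiable ℝ g := hg.differentiable (by norm_num)
  have h2 : ContDiff ℝ 1 (deriv g) :=
    (contDiff_succ_iff_deriv.1 (show ContDiff ℝ ((1 : WithTop ℕ∞) + 1) g from hg)).2.2
  have h3 : Differentiable ℝ (deriv g) := h2.differentiable (by norm_num)
  have h4 : Continuous (deriv (deriv g)) :=
    ((contDiff_succ_iff_deriv.1 (show ContDiff ℝ ((0 : WithTop ℕ∞) + 1) (deriv g) from h2)).2.2).continuous
  refine ⟨fun t => (h1 t).hasDerivAt, fun t => (h3 t).hasDerivAt, h4, ?_⟩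
  obtain ⟨B, hB⟩ := isCompact_Icc.exists_bound_of_continuousOn (h4.continuousOn (s := Icc (-τ) τ))
  exact ⟨B, fun t ht => by simpa [Real.norm_eq_abs] using hB t ht⟩

/-- **Convex squeeze of a derivative**: if `f` has derivative `f₁` on `(−τ,τ)` with `f₁` monotone there (`f` convex), `g` has derivatives
`g₁`, `g₂` with `|g₂| ≤ L` on `(−τ,τ)`, and `|f − g| ≤ ε` on `(−τ,τ)`, then for every `0 < h < τ`: `|f₁(0) − g₁(0)| ≤ L·h + 2ε/h`.
[cite: DemboZeitouni2010, §2.3 (lane lemma: first-order companion of the quasi-linear second-derivative engine)] -/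
private theorem abs_deriv_sub_le_of_convex_squeeze {f f₁ g g₁ g₂ : ℝ → ℝ} {τ L ε h : ℝ} (hh : 0 < h) (hhτ : h < τ)
    (hf : ∀ t ∈ Ioo (-τ) τ, HasDerivAt f (f₁ t) t) (hmono : MonotoneOn f₁ (Ioo (-τ) τ))
    (hg : ∀ t ∈ Ioo (-τ) τ, HasDerivAt g (g₁ t) t) (hg1 : ∀ t ∈ Ioo (-τ) τ, HasDerivAt g₁ (g₂ t) t)
    (hL : ∀ t ∈ Ioo (-τ) τ, |g₂ t| ≤ L) (hε : ∀ t ∈ Ioo (-τ) τ, |f t - g t| ≤ ε) :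
    |f₁ 0 - g₁ 0| ≤ L * h + 2 * ε / h := by
  have hτ : 0 < τ := hh.trans hhτ
  have hL0 : 0 ≤ L := le_trans (abs_nonneg _) (hL 0 ⟨by linarith, hτ⟩)
  have hI : ∀ t ∈ Icc (-h) h, t ∈ Ioo (-τ) τ := fun t ht => ⟨by linarith [ht.1], by linarith [ht.2]⟩
  -- mean value theorem for `f` on `[0,h]` and `[-h,0]`
  have hfc : ∀ a b, -h ≤ a → b ≤ h → a < b → ∃ ξ ∈ Ioo a b, f b - f a = f₁ ξ * (b - a) := by
    intro a b ha hb hab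
    have hd : ∀ t ∈ Icc a b, HasDerivAt f (f₁ t) t := fun t ht => hf t (hI t ⟨by linarith [ht.1], by linarith [ht.2]⟩)
    obtain ⟨ξ, hξ, e⟩ := exists_hasDerivAt_eq_slope f f₁ hab
      (fun t ht => (hd t ht).continuousAt.continuousWithinAt) (fun t ht => hd t ⟨ht.1.le, ht.2.le⟩)
    refine ⟨ξ, hξ, ?_⟩
    rw [e, div_mul_cancel₀ _ (sub_ne_zero.2 hab.ne')]
  -- Taylor bounds for `g`: `|g(±h) − g(0) ∓ h g₁(0)| ≤ L h²/2` — we use the weaker `≤ L h²` via two mean value steps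
  have hgb : ∀ s, s ∈ Icc (-h) h → |g s - g 0 - g₁ 0 * s| ≤ L * h * |s| := by
    intro s hs
    -- `g₁` is `L`-Lipschitz on the interval, so `|g(s) − g(0) − g₁(0)s| ≤ L|s|·|s| ≤ L h |s|`
    rcases lt_trichotomy s 0 with hs0 | hs0 | hs0
    · obtain ⟨ξ, hξ, e⟩ := exists_hasDerivAt_eq_slope g g₁ hs0
        (fun t ht => (hg t (hI t ⟨by linarith [ht.1, hs.1], by linarith [ht.2]⟩)).continuousAt.continuousWithinAt)
        (fun t ht => hg t (hI t ⟨by linarith [ht.1, hs.1], by linarith [ht.2]⟩))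
      obtain ⟨η, hη, e2⟩ := exists_hasDerivAt_eq_slope g₁ g₂ (show ξ < 0 from hξ.2)
        (fun t ht => (hg1 t (hI t ⟨by linarith [ht.1, hξ.1, hs.1], by linarith [ht.2]⟩)).continuousAt.continuousWithinAt)
        (fun t ht => hg1 t (hI t ⟨by linarith [ht.1, hξ.1, hs.1], by linarith [ht.2]⟩))
      have hLη := hL η (hI η ⟨by linarith [hη.1, hξ.1, hs.1], by linarith [hη.2]⟩)
      have e' : g s - g 0 - g₁ 0 * s = (g₁ ξ - g₁ 0) * s := by
        have : g 0 - g s = g₁ ξ * (0 - s) := by rw [e, div_mul_cancel₀ _ (sub_ne_zero.2 hs0.ne')]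
        linarith
      have e2' : g₁ ξ - g₁ 0 = g₂ η * ξ := by
        have : g₁ 0 - g₁ ξ = g₂ η * (0 - ξ) := by rw [e2, div_mul_cancel₀ _ (sub_ne_zero.2 hξ.2.ne')]
        linarith
      rw [e', e2', abs_mul, abs_mul]
      have h1 : |g₂ η| * |ξ| ≤ L * h := by
        have : |ξ| ≤ h := by rw [abs_of_neg hξ.2]; linarith [hξ.1, hs.1]
        exact mul_le_mul hLη this (abs_nonneg _) hL0
      exact mul_le_mul_of_nonneg_right h1 (abs_nonneg _)
    · subst hs0; simp
    · obtain ⟨ξ, hξ, e⟩ := exists_hasDerivAt_eq_slope g g₁ hs0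
        (fun t ht => (hg t (hI t ⟨by linarith [ht.1], by linarith [ht.2, hs.2]⟩)).continuousAt.continuousWithinAt)
        (fun t ht => hg t (hI t ⟨by linarith [ht.1], by linarith [ht.2, hs.2]⟩))
      obtain ⟨η, hη, e2⟩ := exists_hasDerivAt_eq_slope g₁ g₂ (show 0 < ξ from hξ.1)
        (fun t ht => (hg1 t (hI t ⟨by linarith [ht.1], by linarith [ht.2, hξ.2, hs.2]⟩)).continuousAt.continuousWithinAt)
        (fun t ht => hg1 t (hI t ⟨by linarith [ht.1], by linarith [ht.2, hξ.2, hs.2]⟩))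
      have hLη := hL η (hI η ⟨by linarith [hη.1], by linarith [hη.2, hξ.2, hs.2]⟩)
      have e' : g s - g 0 - g₁ 0 * s = (g₁ ξ - g₁ 0) * s := by
        have : g s - g 0 = g₁ ξ * (s - 0) := by rw [e, div_mul_cancel₀ _ (sub_ne_zero.2 hs0.ne')]
        linarith
      have e2' : g₁ ξ - g₁ 0 = g₂ η * ξ := by
        have : g₁ ξ - g₁ 0 = g₂ η * (ξ - 0) := by rw [e2, div_mul_cancel₀ _ (sub_ne_zero.2 hξ.1.ne')]
        linarith
      rw [e', e2', abs_mul, abs_mul]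
      have h1 : |g₂ η| * |ξ| ≤ L * h := by
        have : |ξ| ≤ h := by rw [abs_of_pos hξ.1]; linarith [hξ.2, hs.2]
        exact mul_le_mul hLη this (abs_nonneg _) hL0
      exact mul_le_mul_of_nonneg_right h1 (abs_nonneg _)
  -- upper bound via `[0, h]`: `f₁ 0 ≤ (f h − f 0)/h`
  obtain ⟨ξp, hξp, ep⟩ := hfc 0 h (by linarith) le_rfl hh
  obtain ⟨ξm, hξm, em⟩ := hfc (-h) 0 le_rfl (by linarith) (by linarith)
  have mp : f₁ 0 ≤ f₁ ξp := hmono (show (0:ℝ) ∈ Ioo (-τ) τ from ⟨by linarith, hτ⟩) (hI ξp ⟨by linarith [hξp.1], hξp.2.le⟩) hξp.1.le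
  have mm : f₁ ξm ≤ f₁ 0 := hmono (hI ξm ⟨hξm.1.le, by linarith [hξm.2]⟩) (show (0:ℝ) ∈ Ioo (-τ) τ from ⟨by linarith, hτ⟩) hξm.2.le
  have hεp := hε h (hI h ⟨by linarith, le_rfl⟩)
  have hεm := hε (-h) (hI (-h) ⟨le_rfl, by linarith⟩)
  have hε0 := hε 0 ⟨by linarith, hτ⟩
  have hgp := hgb h ⟨by linarith, le_rfl⟩
  have hgm := hgb (-h) ⟨le_rfl, by linarith⟩
  rw [abs_of_pos hh] at hgp
  rw [abs_of_neg (by linarith : -h < 0), neg_neg] at hgm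
  rw [sub_zero] at ep
  rw [zero_sub] at em
  -- `h f₁ 0 ≤ f h − f 0 ≤ g h − g 0 + 2ε ≤ h g₁ 0 + L h² + 2ε`
  have up : h * (f₁ 0 - g₁ 0) ≤ L * h * h + 2 * ε := by
    have a1 : h * f₁ 0 ≤ f h - f 0 := by nlinarith [mp, ep]
    have a2 := (abs_le.1 hεp).2
    have a3 := (abs_le.1 hε0).1
    have a4 := (abs_le.1 hgp).2
    nlinarith
  have dn : -(L * h * h + 2 * ε) ≤ h * (f₁ 0 - g₁ 0) := by
    have a1 : f 0 - f (-h) ≤ h * f₁ 0 := by nlinarith [mm, em]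
    have a2 := (abs_le.1 hεm).2
    have a3 := (abs_le.1 hε0).1
    have a4 := (abs_le.1 hgm).2
    nlinarith
  rw [abs_le]
  constructor
  · have : -(L * h + 2 * ε / h) * h = -(L * h * h + 2 * ε) := by field_simp
    nlinarith [this]
  · have : (L * h + 2 * ε / h) * h = L * h * h + 2 * ε := by field_simp
    nlinarith [this]

/-! ## §2 ★★★ The mean contact number to second order -/

/-- `√` helper: `a·h + 2e/h ≤ (a + 2)·√((M+1)·e')` for `h = √(e'/(M+1))`, `e ≤ e'`, `a ≤ a'(M+1)` — packaged as the limit statement we need: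
if `0 ≤ ε_M`, `M ε_M → 0`, then with `e'_M = ε_M + (M+1)⁻³` and `h_M = √(e'_M/(M+1))`: `h_M → 0`, `h_M > 0`, and
`(a(M+1) + b)·h_M + 2ε_M/h_M → 0` for all constants `a, b ≥ 0`. [cite: DemboZeitouni2010, §2.3 (lane plumbing)] -/
private theorem squeeze_scale_tendsto {ε : ℕ → ℝ} (hε0 : ∀ M, 0 ≤ ε M) (hε : Tendsto (fun M : ℕ => (M : ℝ) * ε M) atTop (𝓝 0))
    {a b : ℝ} (ha : 0 ≤ a) (hb : 0 ≤ b) :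
    let h : ℕ → ℝ := fun M => Real.sqrt ((ε M + (((M : ℝ) + 1) ^ 3)⁻¹) / ((M : ℝ) + 1))
    (∀ M, 0 < h M) ∧ Tendsto h atTop (𝓝 0) ∧
      Tendsto (fun M : ℕ => (a * ((M : ℝ) + 1) + b) * h M + 2 * ε M / h M) atTop (𝓝 0) := by
  intro h
  have hM1 : ∀ M : ℕ, (0 : ℝ) < (M : ℝ) + 1 := fun M => by positivity
  set e' : ℕ → ℝ := fun M => ε M + (((M : ℝ) + 1) ^ 3)⁻¹ with he'
  have he'pos : ∀ M, 0 < e' M := fun M => by have := hε0 M; positivity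
  have hpos : ∀ M, 0 < h M := fun M => Real.sqrt_pos.2 (div_pos (he'pos M) (hM1 M))
  -- `(M+1) e'_M → 0`
  have h1 : Tendsto (fun M : ℕ => ((M : ℝ) + 1) * ε M) atTop (𝓝 0) := by
    have hε' : Tendsto (fun M : ℕ => ε M) atTop (𝓝 0) := by
      refine squeeze_zero' (Filter.Eventually.of_forall hε0) ?_ hε
      filter_upwards [eventually_ge_atTop 1] with M hM
      have hM1' : (1 : ℝ) ≤ M := by exact_mod_cast hM
      nlinarith [hε0 M]
    have := hε.add hε'
    rw [add_zero] at this
    exact this.congr fun M => by ring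
  have h2 : Tendsto (fun M : ℕ => (((M : ℝ) + 1) ^ 2)⁻¹) atTop (𝓝 0) := by
    have ht : Tendsto (fun M : ℕ => ((M : ℝ) + 1) ^ 2) atTop atTop := by
      have : Tendsto (fun M : ℕ => (M : ℝ) + 1) atTop atTop := tendsto_natCast_atTop_atTop.atTop_add tendsto_const_nhds
      exact this.atTop_mul_atTop₀ this |>.congr fun M => by ring
    exact tendsto_inv_atTop_zero.comp ht
  have h3 : Tendsto (fun M : ℕ => ((M : ℝ) + 1) * e' M) atTop (𝓝 0) := by
    have := h1.add h2
    rw [add_zero] at this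
    refine this.congr fun M => ?_
    simp only [he']
    field_simp
  -- `h_M = √((M+1)e')/(M+1)` → 0 and the bound `= (a + b/(M+1))√((M+1)e') + 2 ε √((M+1)/e') ≤ (a + b + 2) √((M+1) e')`
  have hsq : Tendsto (fun M : ℕ => Real.sqrt (((M : ℝ) + 1) * e' M)) atTop (𝓝 0) := by
    have := (Real.continuous_sqrt.tendsto 0).comp h3
    rwa [Real.sqrt_zero] at this
  have hkey : ∀ M : ℕ, (a * ((M : ℝ) + 1) + b) * h M + 2 * ε M / h M ≤ (a + b + 2) * Real.sqrt (((M : ℝ) + 1) * e' M) := by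
    intro M
    have hm := hM1 M
    have hep := he'pos M
    set S := Real.sqrt (((M : ℝ) + 1) * e' M) with hS
    have hS0 : 0 < S := Real.sqrt_pos.2 (mul_pos hm hep)
    have hSsq : S ^ 2 = ((M : ℝ) + 1) * e' M := Real.sq_sqrt (mul_pos hm hep).le
    -- `h M = S/(M+1)`
    have hh : h M = S / ((M : ℝ) + 1) := by
      show Real.sqrt (e' M / ((M : ℝ) + 1)) = S / ((M : ℝ) + 1)
      have e1 : e' M / ((M : ℝ) + 1) = (((M : ℝ) + 1) * e' M) / ((M : ℝ) + 1) ^ 2 := by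
        field_simp
      rw [e1, Real.sqrt_div' _ (pow_nonneg hm.le 2), Real.sqrt_sq hm.le, hS]
    rw [hh]
    -- `2 ε/h = 2 ε (M+1)/S ≤ 2 e' (M+1)/S = 2 S`
    have t1 : 2 * ε M / (S / ((M : ℝ) + 1)) ≤ 2 * S := by
      rw [div_div_eq_mul_div, div_le_iff₀ hS0]
      have : ε M ≤ e' M := by
        show ε M ≤ ε M + (((M : ℝ) + 1) ^ 3)⁻¹
        have h0 : (0 : ℝ) ≤ (((M : ℝ) + 1) ^ 3)⁻¹ := by positivity
        linarith
      nlinarith [hε0 M, hm]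
    have t2 : (a * ((M : ℝ) + 1) + b) * (S / ((M : ℝ) + 1)) ≤ (a + b) * S := by
      rw [mul_div_assoc']
      rw [div_le_iff₀ hm]
      have : b * S ≤ b * S * ((M : ℝ) + 1) := by
        have h1' : (1 : ℝ) ≤ (M : ℝ) + 1 := by have := (Nat.cast_nonneg M : (0:ℝ) ≤ M); linarith
        nlinarith [mul_nonneg hb hS0.le]
      nlinarith [mul_nonneg ha hS0.le]
    nlinarith
  refine ⟨hpos, ?_, ?_⟩
  · -- `h_M ≤ S_M` (as `M+1 ≥ 1`) and `S_M → 0`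
    refine squeeze_zero (fun M => (hpos M).le) (fun M => ?_) hsq
    have hm := hM1 M
    show Real.sqrt (e' M / ((M : ℝ) + 1)) ≤ Real.sqrt (((M : ℝ) + 1) * e' M)
    apply Real.sqrt_le_sqrt
    rw [div_le_iff₀ hm]
    have h1' : (1 : ℝ) ≤ (M : ℝ) + 1 := by have := (Nat.cast_nonneg M : (0:ℝ) ≤ M); linarith
    nlinarith [he'pos M, mul_nonneg (he'pos M).le hm.le]
  · have h0 : ∀ M : ℕ, 0 ≤ (a * ((M : ℝ) + 1) + b) * h M + 2 * ε M / h M := fun M => by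
      have := hpos M; have := hε0 M; positivity
    have hup : Tendsto (fun M : ℕ => (a + b + 2) * Real.sqrt (((M : ℝ) + 1) * e' M)) atTop (𝓝 0) := by
      have := hsq.const_mul (a + b + 2); rwa [mul_zero] at this
    exact squeeze_zero h0 hkey hup

/-- ★★★ **THE MEAN CONTACT NUMBER TO SECOND ORDER**: for `y, z > 0` and `c ∈ {0,1}`,
`⟨bc⟩_{2M+c,y,z} − (2M+c)·b(y,z) → γ_c(y,z) := d/dA log A_c(e^A, z)|_{A = log y}`,
the logarithmic derivative of the parity amplitude.  Since `A₀ ≠ A₁` for unequal walls (tree: `not_tendsto_stripZ₂_one_two_one`), the `O(1)`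
correction to the mean number of contacts is in general PARITY-DEPENDENT: `⟨bc⟩_N − N·b` oscillates with period two.  Proof: the free energy
`F_N(t) = log C_{1,N}(ye^t,z)` is convex with `F_N'(0) = ⟨bc⟩`; `|F_N − Nφ − G| ≤ ε_N` uniformly (`exists_uniform_log_two_term`), `Nφ + G` has second
derivative `O(N)`; the convex squeeze of §1 with `h_N ≍ √(ε_N/N)` gives `|F_N'(0) − Nφ'(0) − G'(0)| ≲ √(Nε_N) → 0`.
[cite: DemboZeitouni2010, §2.3 (lane statement: first-order expansion under the quasi-linear free energy); MadrasSlade1993, §1.1 eq. (1.1.4) p. 5 (the amplitude); BeatonBousquetMelouDeGierDuminilCopinGuttmann2014, §3.2 Proposition 6 (arXiv v5 p. 10)] -/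
theorem tendsto_meanContacts_sub_linear (hy : 0 < y) (hz : 0 < z) {c : ℕ} (hc : c < 2) :
    Tendsto (fun M : ℕ => meanContacts y z (2 * M + c) - (2 * (M : ℝ) + c) * contactB y z) atTop
      (𝓝 (deriv (fun A => Real.log (parityAmplitude c (Real.exp A) z)) (Real.log y))) := by
  set A₀ := Real.log y with hA₀
  set B := Real.log z with hBdef
  have hyA : Real.exp A₀ = y := Real.exp_log hy
  have hzB : Real.exp B = z := Real.exp_log hz
  -- `Λ` and its derivatives
  obtain ⟨Λ, hΛdef⟩ : ∃ Λ : ℝ → ℝ, Λ = fun A => Real.log (stripMuY₂ 1 (Real.exp A) (Real.exp B)) := ⟨_, rfl⟩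
  have hΛ2 : ContDiff ℝ 2 Λ := by rw [hΛdef]; exact (contDiff_two_log_stripMuY₂_exp B).1
  have hΛd : deriv Λ = fun A => contactB (Real.exp A) (Real.exp B) := by rw [hΛdef]; exact (contDiff_two_log_stripMuY₂_exp B).2
  obtain ⟨hΛ1, hΛ11, hΛ2c, ⟨BΛ, hBΛ⟩⟩ := derivData_of_contDiff_two' hΛ2 (|A₀| + 1)
  have hshift : ∀ t, HasDerivAt (fun t : ℝ => A₀ + t) 1 t := fun t => by simpa using (hasDerivAt_id t).const_add A₀
  -- `G` (C²) and its split `G = cΛ(A₀+·) + Γ`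
  set G : ℝ → ℝ := fun t => (c : ℝ) * Real.log (stripMuY₂ 1 (Real.exp (A₀ + t)) (Real.exp B))
      + Real.log (parityAmplitude c (Real.exp (A₀ + t)) (Real.exp B)) with hG
  have hG2 : ContDiff ℝ 2 G := contDiff_two_parityG A₀ B hc
  obtain ⟨hGd, hG1d, -, ⟨BG, hBG⟩⟩ := derivData_of_contDiff_two' hG2 1
  set Γ : ℝ → ℝ := fun t => Real.log (parityAmplitude c (Real.exp (A₀ + t)) (Real.exp B)) with hΓ
  have hΓeq : Γ = fun t => G t - (c : ℝ) * Λ (A₀ + t) := by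
    funext t; simp only [hΓ, hG, hΛdef]; ring
  have hΓ2 : ContDiff ℝ 2 Γ := by
    rw [hΓeq]; exact hG2.sub (contDiff_const.mul (hΛ2.comp (contDiff_const.add contDiff_id)))
  have hΓdiff : DifferentiableAt ℝ Γ 0 := (hΓ2.differentiable (by norm_num)) 0
  have hΛsdiff : DifferentiableAt ℝ (fun t => (c : ℝ) * Λ (A₀ + t)) 0 :=
    (((hΛ1 (A₀ + 0)).comp 0 (hshift 0)).const_mul (c : ℝ)).differentiableAt
  have hderivG0 : deriv G 0 = (c : ℝ) * contactB y z + deriv (fun A => Real.log (parityAmplitude c (Real.exp A) z)) (Real.log y) := by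
    have e1 : G = fun t => (c : ℝ) * Λ (A₀ + t) + Γ t := by funext t; rw [hΓeq]; ring
    have h1 : HasDerivAt (fun t => (c : ℝ) * Λ (A₀ + t)) ((c : ℝ) * (deriv Λ (A₀ + 0) * 1)) 0 :=
      ((hΛ1 (A₀ + 0)).comp 0 (hshift 0)).const_mul _
    have h2 : HasDerivAt Γ (deriv Γ 0) 0 := hΓdiff.hasDerivAt
    have h12 : HasDerivAt (fun t => (c : ℝ) * Λ (A₀ + t) + Γ t) ((c : ℝ) * (deriv Λ (A₀ + 0) * 1) + deriv Γ 0) 0 := h1.add h2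
    rw [e1, h12.deriv, hΛd, add_zero, mul_one]
    simp only [hyA, hzB]
    have e3 : deriv Γ 0 = deriv (fun A => Real.log (parityAmplitude c (Real.exp A) z)) (Real.log y) := by
      rw [hΓ]
      rw [show (fun t => Real.log (parityAmplitude c (Real.exp (A₀ + t)) (Real.exp B)))
          = fun t => (fun A => Real.log (parityAmplitude c (Real.exp A) z)) (A₀ + t) from by funext t; rw [hzB]]
      have hsh := deriv_comp_const_add (f := fun A => Real.log (parityAmplitude c (Real.exp A) z)) (a := A₀) (x := (0 : ℝ))
      rw [add_zero] at hsh
      rw [hsh]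
    rw [e3]
  -- the uniform remainder on `[y e^{-1}, y e]`
  set y₁ := Real.exp (A₀ - 1) with hy₁def
  set y₂ := Real.exp (A₀ + 1) with hy₂def
  have hy₁ : 0 < y₁ := Real.exp_pos _
  have h12 : y₁ ≤ y₂ := Real.exp_le_exp.2 (by linarith)
  obtain ⟨a₁, a₂, ha₁, hA⟩ := parityAmplitude_bounds hz hy₁ h12 hc
  obtain ⟨ε, hεlim, hεb⟩ := exists_uniform_log_two_term hz hy₁ h12 hc ha₁ hA
    (fun y' hy' => tendsto_parityAmplitude (lt_of_lt_of_le hy₁ hy'.1) hz hc)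
  have hmemI : ∀ t ∈ Ioo (-1 : ℝ) 1, Real.exp (A₀ + t) ∈ Icc y₁ y₂ := fun t ht =>
    ⟨Real.exp_le_exp.2 (by linarith [ht.1]), Real.exp_le_exp.2 (by linarith [ht.2])⟩
  have hε0 : ∀ M, 0 ≤ ε M := fun M => le_trans (abs_nonneg _) (hεb M y₁ ⟨le_rfl, h12⟩)
  -- the scale
  obtain ⟨hhpos, hhlim, hδlim⟩ := squeeze_scale_tendsto hε0 hεlim (a := 2 * BΛ) (b := 2 * BΛ + BG)
    (by have := le_trans (abs_nonneg _) (hBΛ 0 ⟨by have := abs_nonneg A₀; linarith, by have := abs_nonneg A₀; linarith⟩); linarith)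
    (by
      have h1 := le_trans (abs_nonneg _) (hBΛ 0 ⟨by have := abs_nonneg A₀; linarith, by have := abs_nonneg A₀; linarith⟩)
      have h2 := le_trans (abs_nonneg _) (hBG 0 ⟨by norm_num, by norm_num⟩)
      linarith)
  set h : ℕ → ℝ := fun M => Real.sqrt ((ε M + (((M : ℝ) + 1) ^ 3)⁻¹) / ((M : ℝ) + 1)) with hhdef
  -- eventually `h M < 1`
  have hev : ∀ᶠ M : ℕ in atTop, h M < 1 := (Metric.tendsto_atTop.1 hhlim 1 one_pos).imp ?_ |> fun ⟨N₀, hN₀⟩ =>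
    Filter.eventually_atTop.2 ⟨N₀, hN₀⟩
  swap
  · intro N₀ hN₀ M hM
    have := hN₀ M hM
    rw [Real.dist_eq, sub_zero, abs_of_pos (hhpos M)] at this
    exact this
  -- per-`N` facts
  have facts := fun N => contactFreeEnergy_facts hy hz N
  -- the main estimate for `M ≥ 1` with `h M < 1`
  have main : ∀ M : ℕ, 1 ≤ M → h M < 1 →
      |meanContacts y z (2 * M + c) - (2 * (M : ℝ) + c) * contactB y z
        - deriv (fun A => Real.log (parityAmplitude c (Real.exp A) z)) (Real.log y)|
        ≤ (2 * BΛ * ((M : ℝ) + 1) + (2 * BΛ + BG)) * h M + 2 * ε M / h M := by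
    intro M hM hhM
    set N := 2 * M + c with hN
    obtain ⟨hF, hF1, hvnn, -, hmean, -⟩ := facts N
    -- `f = F_N`, `f₁ = mean_t`, monotone
    have hmono : MonotoneOn (fun t => (∑ q ∈ stripPairs 1 N, wgt y z N q * (bottomVisits₀ q.1 q.2 N : ℝ)
        * Real.exp (t * (bottomVisits₀ q.1 q.2 N : ℝ))) / ∑ q ∈ stripPairs 1 N, wgt y z N q * Real.exp (t * (bottomVisits₀ q.1 q.2 N : ℝ)))
        (Ioo (-1 : ℝ) 1) := by
      refine (monotone_of_deriv_nonneg (fun t => (hF1 t).differentiableAt) fun t => ?_).monotoneOn _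
      rw [(hF1 t).deriv]; exact hvnn t
    -- `g = M φ + G` with `φ = 2Λ(A₀+·)`
    set g : ℝ → ℝ := fun t => (M : ℝ) * (2 * Λ (A₀ + t)) + G t with hg
    set g1 : ℝ → ℝ := fun t => (M : ℝ) * (2 * deriv Λ (A₀ + t)) + deriv G t with hg1
    set g2 : ℝ → ℝ := fun t => (M : ℝ) * (2 * deriv (deriv Λ) (A₀ + t)) + deriv (deriv G) t with hg2
    have hgd : ∀ t ∈ Ioo (-1 : ℝ) 1, HasDerivAt g (g1 t) t := by
      intro t _
      have h1 := (((hΛ1 (A₀ + t)).comp t (hshift t)).const_mul 2).const_mul (M : ℝ)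
      have h2 := hGd t
      have := h1.add h2
      simp only [hg, hg1, mul_one] at this ⊢
      exact this
    have hg1d : ∀ t ∈ Ioo (-1 : ℝ) 1, HasDerivAt g1 (g2 t) t := by
      intro t _
      have h1 := (((hΛ11 (A₀ + t)).comp t (hshift t)).const_mul 2).const_mul (M : ℝ)
      have h2 := hG1d t
      have := h1.add h2
      simp only [hg1, hg2, mul_one] at this ⊢
      exact this
    have hL : ∀ t ∈ Ioo (-1 : ℝ) 1, |g2 t| ≤ 2 * BΛ * ((M : ℝ) + 1) + (2 * BΛ + BG) := by
      intro t ht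
      have b1 := hBΛ (A₀ + t) ⟨by have := neg_abs_le A₀; linarith [ht.1], by have := le_abs_self A₀; linarith [ht.2]⟩
      have b2 := hBG t ⟨ht.1.le, ht.2.le⟩
      have hM0 : (0 : ℝ) ≤ M := M.cast_nonneg
      have hBΛ0 : 0 ≤ BΛ := le_trans (abs_nonneg _) b1
      calc |g2 t| ≤ |(M : ℝ) * (2 * deriv (deriv Λ) (A₀ + t))| + |deriv (deriv G) t| := abs_add_le _ _
        _ ≤ (M : ℝ) * (2 * BΛ) + BG := by
            rw [abs_mul, abs_of_nonneg hM0, abs_mul, abs_two]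
            nlinarith
        _ ≤ _ := by nlinarith
    have hεg : ∀ t ∈ Ioo (-1 : ℝ) 1, |Real.log (stripZ₂ 1 N (y * Real.exp t) z) - g t| ≤ ε M := by
      intro t ht
      have hb := hεb M (Real.exp (A₀ + t)) (hmemI t ht)
      have ey : y * Real.exp t = Real.exp (A₀ + t) := by rw [Real.exp_add, hyA]
      have eΛ : Λ (A₀ + t) = Real.log (stripMuY₂ 1 (Real.exp (A₀ + t)) z) := by rw [hΛdef, hzB]
      have eG : G t = (c : ℝ) * Real.log (stripMuY₂ 1 (Real.exp (A₀ + t)) z)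
          + Real.log (parityAmplitude c (Real.exp (A₀ + t)) z) := by simp only [hG, hzB]
      show |Real.log (stripZ₂ 1 N (y * Real.exp t) z) - ((M : ℝ) * (2 * Λ (A₀ + t)) + G t)| ≤ ε M
      rw [ey, eG, eΛ]
      have e : Real.log (stripZ₂ 1 N (Real.exp (A₀ + t)) z) - ((M : ℝ) * (2 * Real.log (stripMuY₂ 1 (Real.exp (A₀ + t)) z))
            + ((c : ℝ) * Real.log (stripMuY₂ 1 (Real.exp (A₀ + t)) z) + Real.log (parityAmplitude c (Real.exp (A₀ + t)) z)))
          = Real.log (stripZ₂ 1 (2 * M + c) (Real.exp (A₀ + t)) z) - (2 * (M : ℝ) + c) * Real.log (stripMuY₂ 1 (Real.exp (A₀ + t)) z)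
            - Real.log (parityAmplitude c (Real.exp (A₀ + t)) z) := by rw [hN]; ring
      rw [e]; exact hb
    have sq := abs_deriv_sub_le_of_convex_squeeze (hhpos M) hhM (fun t _ => hF t) hmono hgd hg1d hL hεg
    -- `f₁ 0 = ⟨bc⟩`, `g1 0 = (2M+c) b + γ_c`
    have eg1 : g1 0 = (2 * (M : ℝ) + c) * contactB y z + deriv (fun A => Real.log (parityAmplitude c (Real.exp A) z)) (Real.log y) := by
      simp only [hg1, add_zero, hderivG0, hΛd, hyA, hzB]; ring
    rw [hmean, eg1] at sq
    have e : meanContacts y z N - ((2 * (M : ℝ) + c) * contactB y z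
          + deriv (fun A => Real.log (parityAmplitude c (Real.exp A) z)) (Real.log y))
        = meanContacts y z (2 * M + c) - (2 * (M : ℝ) + c) * contactB y z
          - deriv (fun A => Real.log (parityAmplitude c (Real.exp A) z)) (Real.log y) := by rw [hN]; ring
    rw [e] at sq
    exact sq
  -- conclude
  rw [Metric.tendsto_atTop]
  intro e he
  obtain ⟨N₁, hN₁⟩ := (Metric.tendsto_atTop.1 hδlim) e he
  obtain ⟨N₂, hN₂⟩ := Filter.eventually_atTop.1 hev
  refine ⟨max (max N₁ N₂) 1, fun M hM => ?_⟩
  have hM1 : 1 ≤ M := le_trans (le_max_right _ _) hM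
  have hMN₁ : N₁ ≤ M := le_trans (le_trans (le_max_left _ _) (le_max_left _ _)) hM
  have hMN₂ : N₂ ≤ M := le_trans (le_trans (le_max_right _ _) (le_max_left _ _)) hM
  have hb := main M hM1 (hN₂ M hMN₂)
  have hd := hN₁ M hMN₁
  rw [Real.dist_eq, sub_zero] at hd
  rw [Real.dist_eq]
  exact lt_of_le_of_lt hb (lt_of_le_of_lt (le_abs_self _) hd)

end WidthOneYZ

end Literature.Probability.RandomPlanarGeometry.SAW.HexBW
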